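import Literature.Computability.QuantumComplexity.EffectiveCompiler
import Literature.Computability.Complexity.CodeFPBudgets
import Literature.Computability.Complexity.CodeFPLists
import HarnessLib

/-!
# The effective compiler on codes, I: arithmetic and one round (effective compiler, V)

Fifth file of the effective gate compiler behind `PromiseBQPOver_eq_PromiseBQP`: the program of
`NetCompilerSpec.lean` is mirrored in the typed polynomial-time algebra `CodeFP` (`Complexity/CodeFP*.lean`),
which is what eventually makes the compiler `GateCompiler.ExpTime` (polynomial time in the unary
budget, i.e. in the inverse accuracy). This file covers the arithmetic and ONE ROUND; the run (the
fold over the budget with its accumulator bound), the lookup and the parameters are in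
`EffectiveCompilerFP.lean`.

* **Codes**: `gE` (a Gaussian integer as the pair of the integer codes `intE` of its components;
  the same code as `zgE ∘ zgOf` of `Complexity/CodeFPLists.lean`, bridges `gE_eq_zgE_zgOf`,
  `codeFP_zgOf`),
  matrices as raw lists of COLUMNS (`colsOf`, `matE`; the constant generator matrices by ROWS,
  `rowsOf`, so that a left multiplication is a table of dot products), contexts
  `Ctx = (2ᵖ, B, T², 4ᵖ, generator rows)` (`Params.ctx`), list elements / states (`ElemL`, `StL`,
  `encElem`, `encSt`).
* **List twins** of the program — `roundMulL`, `clampL`, `froSqL`, `finnerL`, `closeTestL`, `candL`,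
  `isFarL`, `farCandsL`, `stepL` — with the equations identifying them with the matrix-level program
  on encoded data (`roundMulL_rowsOf_colsOf`, `closeTestL_colsOf`, `candL_ctx_colsOf`,
  `farCandsL_ctx`, **`stepL_ctx : stepL m P.ctx (encSt st) = encSt (P.step st)`**).
* **On codes**: `codeFP_gmul`, `codeFP_gstarMul`, `codeFP_gnorm`, `codeFP_gsum`, `codeFP_rdivS`,
  `codeFP_clampG`, `codeFP_dotL`, `codeFP_roundMulL`, `codeFP_clampL`, `codeFP_froSqL`,
  `codeFP_finnerL`, `codeFP_closeTestL`, `codeFP_candL`, `codeFP_isFarL`, `codeFP_farCandsL`,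
  **`codeFP_stepL`** — assembled from the combinators `map`, `zipWith`, `filter`, `all`, `rawCases`,
  `rawGetD`/`rawGetOr`, `intAdd/intSub/intMul/intEDiv/intLe`, `intSum` of the `CodeFP` files; no
  machine or transducer is written.

Everything is proved; no named facts. (Elaboration note for maintainers: composite `CodeFP` terms are
always re-typed through `.congr fun _ => rfl`, which keeps unification first-order.)

## References

* S. Arora, B. Barak, *Computational Complexity: A Modern Approach*, CUP 2009, §1.3 (polynomial-time
  computable functions: composition and polynomially bounded loops) [AroraBarak2009].
* C. M. Dawson, M. A. Nielsen, *The Solovay–Kitaev algorithm*, Quantum Inf. Comput. 6 (2006), §5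
  [DawsonNielsen2006].
-/

noncomputable section

namespace Literature.Computability.QuantumComplexity

open _root_.Computability Complexity Complexity.CodeFP Cryptography GaussianInt

namespace NetCompiler

variable {m : ℕ}

/-! ### Codes of Gaussian integers -/

/-- The code of a Gaussian integer: the pair of the integer codes of its components — literally
`zgE (zgOf z)` for the pair presentation `zgOf`, `zgE = pairE intE intE` of `CodeFPLists.lean`
(`gE_eq_zgE_zgOf`); the typed operations below are stated directly on Mathlib's `GaussianInt`, which
is the type the compiler's matrices (`GMat`, `DyadicMatrices.lean`) are over. [folklore] -/
def gE : GaussianInt → List Bool := fun z => pairE intE intE (z.re, z.im)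

/-- Unfolding of `gE`. [folklore] -/
theorem gE_apply (z : GaussianInt) : gE z = pairE intE intE (z.re, z.im) := rfl

/-- **Bridge to `CodeFPLists.lean`**: `gE = zgE ∘ zgOf`. [folklore] -/
theorem gE_eq_zgE_zgOf (z : GaussianInt) : gE z = zgE (zgOf z) := rfl

/-- The product on codes is also `zgMul_codeFP` of `CodeFPLists.lean` transported along `zgOf`
(`zgOf_mul`); recorded as a bridge. [folklore] -/
theorem codeFP_zgOf : CodeFP gE zgE zgOf := CodeFP.transparent fun _ => rfl

/-- Real part on codes. [folklore] -/
theorem codeFP_gre : CodeFP gE intE fun z : GaussianInt => z.re := ⟨Brick.fstF, Brick.fstF_mem_FP, fun z => by simp [gE]⟩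

/-- Imaginary part on codes. [folklore] -/
theorem codeFP_gim : CodeFP gE intE fun z : GaussianInt => z.im := ⟨Brick.sndF, Brick.sndF_mem_FP, fun z => by simp [gE]⟩

/-- Assembling a Gaussian integer on codes. [folklore] -/
theorem codeFP_gmk : CodeFP (pairE intE intE) gE fun p : ℤ × ℤ => (⟨p.1, p.2⟩ : GaussianInt) :=
  CodeFP.of_fn _root_.id (PolyTimeComputable.id _) fun _ => rfl

variable {α : Type} {eα : α → List Bool}

/-- Assembling a Gaussian integer from two computed components. [folklore] -/
theorem codeFP_gmk' {f g : α → ℤ} (hf : CodeFP eα intE f) (hg : CodeFP eα intE g) :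
    CodeFP eα gE fun a => (⟨f a, g a⟩ : GaussianInt) :=
  (codeFP_gmk.comp (hf.pair hg)).congr fun _ => rfl

/-- **Product of Gaussian integers on codes** (`re = ac - bd`, `im = ad + bc`). [folklore] -/
theorem codeFP_gmul : CodeFP (pairE gE gE) gE fun p : GaussianInt × GaussianInt => p.1 * p.2 := by
  have ha : CodeFP (pairE gE gE) intE fun p : GaussianInt × GaussianInt => p.1.re := codeFP_gre.comp (fst _ _)
  have hb : CodeFP (pairE gE gE) intE fun p : GaussianInt × GaussianInt => p.1.im := codeFP_gim.comp (fst _ _)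
  have hc : CodeFP (pairE gE gE) intE fun p : GaussianInt × GaussianInt => p.2.re := codeFP_gre.comp (snd _ _)
  have hd : CodeFP (pairE gE gE) intE fun p : GaussianInt × GaussianInt => p.2.im := codeFP_gim.comp (snd _ _)
  refine (codeFP_gmk' (intSub.comp ((intMul.comp (ha.pair hc)).pair (intMul.comp (hb.pair hd))))
    (intAdd.comp ((intMul.comp (ha.pair hd)).pair (intMul.comp (hb.pair hc))))).congr fun p => Zsqrtd.ext ?_ ?_
  · change p.1.re * p.2.re - p.1.im * p.2.im = (p.1 * p.2).re
    rw [Zsqrtd.re_mul]; ring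
  · change p.1.re * p.2.im + p.1.im * p.2.re = (p.1 * p.2).im
    rw [Zsqrtd.im_mul]

/-- **`conj a · b` on codes** (`re = ac + bd`, `im = ad - bc`). [folklore] -/
theorem codeFP_gstarMul : CodeFP (pairE gE gE) gE fun p : GaussianInt × GaussianInt => star p.1 * p.2 := by
  have ha : CodeFP (pairE gE gE) intE fun p : GaussianInt × GaussianInt => p.1.re := codeFP_gre.comp (fst _ _)
  have hb : CodeFP (pairE gE gE) intE fun p : GaussianInt × GaussianInt => p.1.im := codeFP_gim.comp (fst _ _)
  have hc : CodeFP (pairE gE gE) intE fun p : GaussianInt × GaussianInt => p.2.re := codeFP_gre.comp (snd _ _)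
  have hd : CodeFP (pairE gE gE) intE fun p : GaussianInt × GaussianInt => p.2.im := codeFP_gim.comp (snd _ _)
  refine (codeFP_gmk' (intAdd.comp ((intMul.comp (ha.pair hc)).pair (intMul.comp (hb.pair hd))))
    (intSub.comp ((intMul.comp (ha.pair hd)).pair (intMul.comp (hb.pair hc))))).congr fun p => Zsqrtd.ext ?_ ?_
  · change p.1.re * p.2.re + p.1.im * p.2.im = (star p.1 * p.2).re
    rw [Zsqrtd.re_mul, Zsqrtd.re_star, Zsqrtd.im_star]; ring
  · change p.1.re * p.2.im - p.1.im * p.2.re = (star p.1 * p.2).im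
    rw [Zsqrtd.im_mul, Zsqrtd.re_star, Zsqrtd.im_star]; ring

/-- **The norm `re² + im²` on codes.** [folklore] -/
theorem codeFP_gnorm : CodeFP gE intE fun z : GaussianInt => z.norm :=
  (intAdd.comp ((intMul.comp (codeFP_gre.pair codeFP_gre)).pair (intMul.comp (codeFP_gim.pair codeFP_gim)))).congr
    fun z => by rw [Zsqrtd.norm_def]; ring

/-- The real part of a sum. [folklore] -/
theorem re_list_sum (l : List GaussianInt) : l.sum.re = (l.map fun z => z.re).sum := by
  induction l with
  | nil => rfl
  | cons a l ih => rw [List.sum_cons, Zsqrtd.re_add, ih, List.map_cons, List.sum_cons]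

/-- The imaginary part of a sum. [folklore] -/
theorem im_list_sum (l : List GaussianInt) : l.sum.im = (l.map fun z => z.im).sum := by
  induction l with
  | nil => rfl
  | cons a l ih => rw [List.sum_cons, Zsqrtd.im_add, ih, List.map_cons, List.sum_cons]

/-- **Sums of raw lists of Gaussian integers on codes** (componentwise `intSum`). [folklore] -/
theorem codeFP_gsum : CodeFP (rawE gE) gE (List.sum : List GaussianInt → GaussianInt) :=
  (codeFP_gmk' (intSum.comp (map₀ codeFP_gre)) (intSum.comp (map₀ codeFP_gim))).congr fun l => by
    ext
    · exact (re_list_sum l).symm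
    · exact (im_list_sum l).symm

/-- Floor division of a Gaussian integer by an integer, componentwise. [folklore] -/
def rdivS (S : ℤ) (z : GaussianInt) : GaussianInt := ⟨z.re / S, z.im / S⟩

/-- `rdivS (2ᵖ) = rdiv p`. [folklore] -/
theorem rdivS_two_pow (p : ℕ) (z : GaussianInt) : rdivS (2 ^ p) z = rdiv p z := rfl

/-- `rdivS` on codes. [folklore] -/
theorem codeFP_rdivS : CodeFP (pairE intE gE) gE fun p : ℤ × GaussianInt => rdivS p.1 p.2 := by
  have hS : CodeFP (pairE intE gE) intE fun p : ℤ × GaussianInt => p.1 := fst _ _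
  have hre : CodeFP (pairE intE gE) intE fun p : ℤ × GaussianInt => p.2.re := (codeFP_gre.comp (snd _ _)).congr fun _ => rfl
  have him : CodeFP (pairE intE gE) intE fun p : ℤ × GaussianInt => p.2.im := (codeFP_gim.comp (snd _ _)).congr fun _ => rfl
  have h1 : CodeFP (pairE intE gE) intE fun p : ℤ × GaussianInt => p.2.re / p.1 := (intEDiv.comp (hre.pair hS)).congr fun _ => rfl
  have h2 : CodeFP (pairE intE gE) intE fun p : ℤ × GaussianInt => p.2.im / p.1 := (intEDiv.comp (him.pair hS)).congr fun _ => rfl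
  exact (codeFP_gmk' h1 h2).congr fun _ => rfl

/-- `clampZ` on codes (two comparisons). [folklore] -/
theorem codeFP_clampZ : CodeFP (pairE intE intE) intE fun p : ℤ × ℤ => clampZ p.1 p.2 := by
  have hB : CodeFP (pairE intE intE) intE fun p : ℤ × ℤ => p.1 := fst _ _
  have ha : CodeFP (pairE intE intE) intE fun p : ℤ × ℤ => p.2 := snd _ _
  have hnB : CodeFP (pairE intE intE) intE fun p : ℤ × ℤ => -p.1 := (intNeg.comp hB).congr fun _ => rfl
  have hmin : CodeFP (pairE intE intE) intE fun p : ℤ × ℤ => min p.1 p.2 :=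
    ((intLe.comp (hB.pair ha)).ite hB ha).congr fun p => by
      simp only [decide_eq_true_eq]; split_ifs with h <;> omega
  exact ((intLe.comp (hnB.pair hmin)).ite hmin hnB).congr fun p => by
    simp only [clampZ, decide_eq_true_eq]; split_ifs with h <;> omega

/-- `clampG` on codes. [folklore] -/
theorem codeFP_clampG : CodeFP (pairE intE gE) gE fun p : ℤ × GaussianInt => clampG p.1 p.2 := by
  have hB : CodeFP (pairE intE gE) intE fun p : ℤ × GaussianInt => p.1 := fst _ _
  have hre : CodeFP (pairE intE gE) intE fun p : ℤ × GaussianInt => p.2.re := (codeFP_gre.comp (snd _ _)).congr fun _ => rfl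
  have him : CodeFP (pairE intE gE) intE fun p : ℤ × GaussianInt => p.2.im := (codeFP_gim.comp (snd _ _)).congr fun _ => rfl
  have h1 : CodeFP (pairE intE gE) intE fun p : ℤ × GaussianInt => clampZ p.1 p.2.re := (codeFP_clampZ.comp (hB.pair hre)).congr fun _ => rfl
  have h2 : CodeFP (pairE intE gE) intE fun p : ℤ × GaussianInt => clampZ p.1 p.2.im := (codeFP_clampZ.comp (hB.pair him)).congr fun _ => rfl
  exact (codeFP_gmk' h1 h2).congr fun _ => rfl

/-! ### Matrices as lists of columns -/

/-- The fixed enumeration of the basis labels. [folklore] -/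
def qregList (m : ℕ) : List (QReg m) := (Finset.univ : Finset (QReg m)).toList

/-- **The column list of a matrix** (the compiler's format for stored matrices). [folklore] -/
def colsOf (X : GMat m) : List (List GaussianInt) := (qregList m).map fun j => (qregList m).map fun i => X i j

/-- **The row list of a matrix** (the format of the constant generator matrices). [folklore] -/
def rowsOf (A : GMat m) : List (List GaussianInt) := (qregList m).map fun i => (qregList m).map fun k => A i k

/-- The code of a stored matrix: the raw list of its columns. [folklore] -/
def matE : GMat m → List Bool := fun X => rawE (rawE gE) (colsOf X)

/-- Sums over the enumeration are sums over the register. [folklore] -/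
theorem sum_map_qregList {M : Type} [AddCommMonoid M] (f : QReg m → M) :
    ((qregList m).map f).sum = ∑ x, f x := Finset.sum_map_toList _ _

/-- The dot product of two lists. [folklore] -/
def dotL (r c : List GaussianInt) : GaussianInt := (List.zipWith (fun x y => x * y) r c).sum

/-- **Row times column is the matrix entry of the product.** [folklore] -/
theorem dotL_row_col (A X : GMat m) (i j : QReg m) :
    dotL ((qregList m).map fun k => A i k) ((qregList m).map fun k => X k j) = (A * X) i j := by
  rw [dotL, List.zipWith_map, List.zipWith_self, sum_map_qregList, Matrix.mul_apply]

/-- The rounded product on column lists, for a matrix given by rows. [folklore] -/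
def roundMulL (S : ℤ) (Arows Xcols : List (List GaussianInt)) : List (List GaussianInt) :=
  Xcols.map fun c => Arows.map fun r => rdivS S (dotL r c)

/-- **`roundMulL` computes `roundMul`.** [folklore] -/
theorem roundMulL_rowsOf_colsOf (p : ℕ) (A X : GMat m) :
    roundMulL (2 ^ p) (rowsOf A) (colsOf X) = colsOf (roundMul p A X) := by
  simp only [roundMulL, rowsOf, colsOf, List.map_map, roundMul, Matrix.map_apply]
  refine List.map_congr_left fun j _ => ?_
  simp only [Function.comp_apply]
  refine List.map_congr_left fun i _ => ?_
  rw [Function.comp_apply, dotL_row_col, rdivS_two_pow]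

/-- Clamping on column lists. [folklore] -/
def clampL (B : ℤ) (Xcols : List (List GaussianInt)) : List (List GaussianInt) := Xcols.map fun c => c.map (clampG B)

/-- `clampL` computes `clampMat`. [folklore] -/
theorem clampL_colsOf (B : ℤ) (X : GMat m) : clampL B (colsOf X) = colsOf (clampMat B X) := by
  simp [clampL, colsOf, clampMat, List.map_map, Function.comp_def]

/-- The integer squared Frobenius norm on column lists. [folklore] -/
def froSqL (Xcols : List (List GaussianInt)) : ℤ := (Xcols.map fun c => (c.map fun z => z.norm).sum).sum

/-- `froSqL` computes `froSqZ`. [folklore] -/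
theorem froSqL_colsOf (X : GMat m) : froSqL (colsOf X) = froSqZ X := by
  simp only [froSqL, colsOf, List.map_map, Function.comp_def, sum_map_qregList, froSqZ]
  exact Finset.sum_comm

/-- The Hilbert–Schmidt inner product on column lists. [folklore] -/
def finnerL (Xcols Ycols : List (List GaussianInt)) : GaussianInt :=
  (List.zipWith (fun c c' => (List.zipWith (fun x y => star x * y) c c').sum) Xcols Ycols).sum

/-- `finnerL` computes `finnerZ`. [folklore] -/
theorem finnerL_colsOf (X Y : GMat m) : finnerL (colsOf X) (colsOf Y) = finnerZ X Y := by
  simp only [finnerL, colsOf, List.zipWith_map, List.zipWith_self, sum_map_qregList, finnerZ]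
  exact Finset.sum_comm

/-- The closeness test on column lists, with the multipliers `T²` and `4ᵖ` given. [folklore] -/
def closeTestL (T2 S2 : ℤ) (Xcols Ycols : List (List GaussianInt)) : Bool :=
  decide (T2 * (froSqL Xcols + froSqL Ycols) - S2 ≤ 0 ∨
    (T2 * (froSqL Xcols + froSqL Ycols) - S2) ^ 2 ≤ 4 * T2 ^ 2 * (finnerL Xcols Ycols).norm)

/-- `closeTestL (T²) (4ᵖ)` computes `closeTest p T`. [folklore] -/
theorem closeTestL_colsOf (p T : ℕ) (X Y : GMat m) :
    closeTestL ((T : ℤ) ^ 2) (4 ^ p) (colsOf X) (colsOf Y) = closeTest p T X Y := by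
  have h4 : ((T : ℤ) ^ 2) ^ 2 = (T : ℤ) ^ 4 := by ring
  simp only [closeTestL, froSqL_colsOf, finnerL_colsOf, closeTest, closeNum, h4, decide_eq_decide]

/-! ### The operations on codes -/

/-- `dotL` on codes. [folklore] -/
theorem codeFP_dotL : CodeFP (pairE (rawE gE) (rawE gE)) gE fun p : List GaussianInt × List GaussianInt => dotL p.1 p.2 :=
  (codeFP_gsum.comp ((CodeFP.zipWith (σ := Unit) (eσ := unitE) (codeFP_gmul.comp (snd _ _))).comp
    ((const _ ()).pair (CodeFP.id _)))).congr fun _ => rfl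

/-- `roundMulL` on codes. [folklore] -/
theorem codeFP_roundMulL :
    CodeFP (pairE intE (pairE (rawE (rawE gE)) (rawE (rawE gE)))) (rawE (rawE gE))
      fun p : ℤ × (List (List GaussianInt) × List (List GaussianInt)) => roundMulL p.1 p.2.1 p.2.2 := by
  -- inner: context `(S, c)`, item `r` ↦ `rdivS S (dotL r c)`
  have hinner : CodeFP (pairE (pairE intE (rawE gE)) (rawE gE)) gE
      fun t : (ℤ × List GaussianInt) × List GaussianInt => rdivS t.1.1 (dotL t.2 t.1.2) :=
    (codeFP_rdivS.comp ((fst _ _).fst'.pair ((codeFP_dotL.comp ((snd _ _).pair (fst _ _).snd')).congr fun _ => rfl))).congr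
      fun _ => rfl
  -- middle: context `(S, Arows)`, item `c` ↦ `Arows.map (fun r => rdivS S (dotL r c))`
  have hmid : CodeFP (pairE (pairE intE (rawE (rawE gE))) (rawE gE)) (rawE gE)
      fun t : (ℤ × List (List GaussianInt)) × List GaussianInt => t.1.2.map fun r => rdivS t.1.1 (dotL r t.2) :=
    ((map hinner).comp (((fst _ _).fst'.pair (snd _ _)).pair (fst _ _).snd')).congr fun t => rfl
  exact ((map hmid).comp (((fst _ _).pair (snd _ _).fst').pair (snd _ _).snd')).congr fun p => rfl

/-- `clampL` on codes. [folklore] -/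
theorem codeFP_clampL : CodeFP (pairE intE (rawE (rawE gE))) (rawE (rawE gE))
    fun p : ℤ × List (List GaussianInt) => clampL p.1 p.2 := by
  have hinner : CodeFP (pairE intE (rawE gE)) (rawE gE) fun t : ℤ × List GaussianInt => t.2.map (clampG t.1) :=
    (map codeFP_clampG).congr fun t => rfl
  exact (map (hinner.comp ((fst _ _).pair (snd _ _)))).congr fun p => rfl

/-- `froSqL` on codes. [folklore] -/
theorem codeFP_froSqL : CodeFP (rawE (rawE gE)) intE froSqL :=
  (intSum.comp (map₀ (intSum.comp (map₀ codeFP_gnorm)))).congr fun _ => rfl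

/-- `finnerL` on codes. [folklore] -/
theorem codeFP_finnerL : CodeFP (pairE (rawE (rawE gE)) (rawE (rawE gE))) gE
    fun p : List (List GaussianInt) × List (List GaussianInt) => finnerL p.1 p.2 := by
  have hinner : CodeFP (pairE unitE (pairE (rawE gE) (rawE gE))) gE
      fun t : Unit × (List GaussianInt × List GaussianInt) => (List.zipWith (fun x y => star x * y) t.2.1 t.2.2).sum :=
    (codeFP_gsum.comp ((CodeFP.zipWith (σ := Unit) (eσ := unitE) (codeFP_gstarMul.comp (snd _ _))).comp
      ((const _ ()).pair (snd _ _)))).congr fun t => rfl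
  exact (codeFP_gsum.comp ((CodeFP.zipWith (σ := Unit) (eσ := unitE) hinner).comp
    ((const _ ()).pair (CodeFP.id _)))).congr fun p => rfl

/-- `closeTestL` on codes. [folklore] -/
theorem codeFP_closeTestL :
    CodeFP (pairE (pairE intE intE) (pairE (rawE (rawE gE)) (rawE (rawE gE)))) bitE
      fun p : (ℤ × ℤ) × (List (List GaussianInt) × List (List GaussianInt)) => closeTestL p.1.1 p.1.2 p.2.1 p.2.2 := by
  have hT2 : CodeFP (pairE (pairE intE intE) (pairE (rawE (rawE gE)) (rawE (rawE gE)))) intE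
      fun p : (ℤ × ℤ) × (List (List GaussianInt) × List (List GaussianInt)) => p.1.1 := (fst _ _).fst'
  have hS2 : CodeFP (pairE (pairE intE intE) (pairE (rawE (rawE gE)) (rawE (rawE gE)))) intE
      fun p : (ℤ × ℤ) × (List (List GaussianInt) × List (List GaussianInt)) => p.1.2 := (fst _ _).snd'
  have hX : CodeFP (pairE (pairE intE intE) (pairE (rawE (rawE gE)) (rawE (rawE gE)))) intE
      fun p : (ℤ × ℤ) × (List (List GaussianInt) × List (List GaussianInt)) => froSqL p.2.1 := (codeFP_froSqL.comp (snd _ _).fst').congr fun _ => rfl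
  have hY : CodeFP (pairE (pairE intE intE) (pairE (rawE (rawE gE)) (rawE (rawE gE)))) intE
      fun p : (ℤ × ℤ) × (List (List GaussianInt) × List (List GaussianInt)) => froSqL p.2.2 := (codeFP_froSqL.comp (snd _ _).snd').congr fun _ => rfl
  have hI : CodeFP (pairE (pairE intE intE) (pairE (rawE (rawE gE)) (rawE (rawE gE)))) intE
      fun p : (ℤ × ℤ) × (List (List GaussianInt) × List (List GaussianInt)) => (finnerL p.2.1 p.2.2).norm :=
    (codeFP_gnorm.comp ((codeFP_finnerL.comp (snd _ _)).congr fun _ => rfl)).congr fun _ => rfl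
  have hn : CodeFP (pairE (pairE intE intE) (pairE (rawE (rawE gE)) (rawE (rawE gE)))) intE
      fun p : (ℤ × ℤ) × (List (List GaussianInt) × List (List GaussianInt)) => p.1.1 * (froSqL p.2.1 + froSqL p.2.2) - p.1.2 := by
    have ha : CodeFP (pairE (pairE intE intE) (pairE (rawE (rawE gE)) (rawE (rawE gE)))) intE
        fun p : (ℤ × ℤ) × (List (List GaussianInt) × List (List GaussianInt)) => froSqL p.2.1 + froSqL p.2.2 :=
      (intAdd.comp (hX.pair hY)).congr fun _ => rfl
    have hb : CodeFP (pairE (pairE intE intE) (pairE (rawE (rawE gE)) (rawE (rawE gE)))) intE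
        fun p : (ℤ × ℤ) × (List (List GaussianInt) × List (List GaussianInt)) => p.1.1 * (froSqL p.2.1 + froSqL p.2.2) :=
      (intMul.comp (hT2.pair ha)).congr fun _ => rfl
    exact (intSub.comp (hb.pair hS2)).congr fun _ => rfl
  have h1 : CodeFP (pairE (pairE intE intE) (pairE (rawE (rawE gE)) (rawE (rawE gE)))) bitE
      fun p : (ℤ × ℤ) × (List (List GaussianInt) × List (List GaussianInt)) =>
        decide (p.1.1 * (froSqL p.2.1 + froSqL p.2.2) - p.1.2 ≤ 0) := (intLe.comp (hn.pair (const _ 0))).congr fun _ => rfl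
  have h2 : CodeFP (pairE (pairE intE intE) (pairE (rawE (rawE gE)) (rawE (rawE gE)))) bitE
      fun p : (ℤ × ℤ) × (List (List GaussianInt) × List (List GaussianInt)) =>
        decide ((p.1.1 * (froSqL p.2.1 + froSqL p.2.2) - p.1.2) ^ 2 ≤ 4 * p.1.1 ^ 2 * (finnerL p.2.1 p.2.2).norm) :=
    by
    have hl : CodeFP (pairE (pairE intE intE) (pairE (rawE (rawE gE)) (rawE (rawE gE)))) intE
        fun p : (ℤ × ℤ) × (List (List GaussianInt) × List (List GaussianInt)) =>
          (p.1.1 * (froSqL p.2.1 + froSqL p.2.2) - p.1.2) ^ 2 :=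
      (intMul.comp (hn.pair hn)).congr fun _ => by simp only [sq]
    have h4 : CodeFP (pairE (pairE intE intE) (pairE (rawE (rawE gE)) (rawE (rawE gE)))) intE
        fun p : (ℤ × ℤ) × (List (List GaussianInt) × List (List GaussianInt)) => 4 * p.1.1 ^ 2 :=
      (intMul.comp ((const _ 4).pair ((intMul.comp (hT2.pair hT2)).congr fun _ => rfl))).congr fun _ => by simp only [sq]
    have hr : CodeFP (pairE (pairE intE intE) (pairE (rawE (rawE gE)) (rawE (rawE gE)))) intE
        fun p : (ℤ × ℤ) × (List (List GaussianInt) × List (List GaussianInt)) => 4 * p.1.1 ^ 2 * (finnerL p.2.1 p.2.2).norm :=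
      (intMul.comp (h4.pair hI)).congr fun _ => rfl
    exact (intLe.comp (hl.pair hr)).congr fun _ => rfl
  exact (h1.or h2).congr fun p => by simp only [closeTestL, Bool.decide_or]


/-! ### One round on lists -/

/-- **The context of a run**: the scale `2ᵖ`, the clamp bound `B`, the test multipliers `T²` and
`4ᵖ`, and the generator matrices by rows. [folklore] -/
abbrev Ctx : Type := ℤ × (ℤ × (ℤ × (ℤ × List (List (List GaussianInt)))))

/-- The code of a context. [folklore] -/
abbrev Ctx.E : Ctx → List Bool := pairE intE (pairE intE (pairE intE (pairE intE (rawE (rawE (rawE gE))))))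

/-- The context of the run with parameters `P`. [folklore] -/
def Params.ctx (P : Params m) : Ctx := (((2 ^ P.p : ℕ) : ℤ), (P.B, (((P.T : ℤ) ^ 2), ((4 : ℤ) ^ P.p, P.gens.map rowsOf))))

/-- Elements of the net on lists: a word and a column list. [folklore] -/
abbrev ElemL : Type := List ℕ × List (List GaussianInt)

/-- The code of a list element. [folklore] -/
abbrev ElemL.E : ElemL → List Bool := pairE (rawE natE) (rawE (rawE gE))

/-- States on lists: a pointer and a list of list elements. [folklore] -/
abbrev StL : Type := ℕ × List ElemL

/-- The code of a list state. [folklore] -/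
abbrev StL.E : StL → List Bool := pairE natE (rawE ElemL.E)

/-- The list form of an element. [folklore] -/
def encElem (e : Elem m) : ElemL := (e.1, colsOf e.2)

/-- The list form of a state. [folklore] -/
def encSt (st : ℕ × List (Elem m)) : StL := (st.1, st.2.map encElem)

/-- The column list of the zero matrix (the default of the list program). [folklore] -/
def zeroCols (m : ℕ) : List (List GaussianInt) := colsOf (0 : GMat m)

/-- The candidate on lists. [folklore] -/
def candL (c : Ctx) (Xc : List (List GaussianInt)) (i : ℕ) : List (List GaussianInt) :=
  clampL c.2.1 (roundMulL c.1 (c.2.2.2.2.getD i []) Xc)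

/-- The farness test on lists. [folklore] -/
def isFarL (c : Ctx) (net : List ElemL) (Yc : List (List GaussianInt)) : Bool :=
  net.all fun e => !closeTestL c.2.2.1 c.2.2.2.1 Yc e.2

/-- The far candidates on lists. [folklore] -/
def farCandsL (c : Ctx) (net : List ElemL) (e : ElemL) : List ElemL :=
  ((List.range c.2.2.2.2.length).map fun i => (e.1 ++ [i], candL c e.2 i)).filter fun x => isFarL c net x.2

/-- **One round on lists.** [folklore] -/
def stepL (m : ℕ) (c : Ctx) (st : StL) : StL :=
  if st.1 < st.2.length then
    match farCandsL c st.2 (st.2.getD st.1 ([], zeroCols m)) with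
    | [] => (st.1 + 1, st.2)
    | x :: _ => (st.1, st.2 ++ [x])
  else st

section Twin

variable (P : Params m)

/-- `candL` computes `cand`. [folklore] -/
theorem candL_ctx_colsOf (X : GMat m) {i : ℕ} (hi : i < P.gens.length) :
    candL P.ctx (colsOf X) i = colsOf (P.cand X i) := by
  have hg : (P.gens.map rowsOf).getD i [] = rowsOf (P.gens.getD i 0) := by
    rw [List.getD_eq_getElem _ _ (by simpa using hi), List.getElem_map, List.getD_eq_getElem _ _ hi]
  simp only [candL, Params.ctx, hg]
  rw [show (((2 ^ P.p : ℕ) : ℤ)) = 2 ^ P.p by push_cast; rfl, roundMulL_rowsOf_colsOf, clampL_colsOf, Params.cand]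

/-- `isFarL` computes `isFar`. [folklore] -/
theorem isFarL_ctx (net : List (Elem m)) (Y : GMat m) :
    isFarL P.ctx (net.map encElem) (colsOf Y) = P.isFar net Y := by
  simp only [isFarL, Params.isFar, List.all_map, Params.ctx, Function.comp_def, encElem, closeTestL_colsOf]

/-- `farCandsL` computes `farCands`. [folklore] -/
theorem farCandsL_ctx (net : List (Elem m)) (e : Elem m) :
    farCandsL P.ctx (net.map encElem) (encElem e) = (P.farCands net e).map encElem := by
  have hlen : (P.ctx).2.2.2.2.length = P.gens.length := by simp [Params.ctx]
  have hmap : ((List.range P.gens.length).map fun i => ((encElem e).1 ++ [i], candL P.ctx (encElem e).2 i)) =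
      ((List.range P.gens.length).map fun i => (e.1 ++ [i], P.cand e.2 i)).map encElem := by
    rw [List.map_map]
    refine List.map_congr_left fun i hi => ?_
    rw [List.mem_range] at hi
    simp only [Function.comp_apply, encElem, candL_ctx_colsOf P e.2 hi]
  rw [farCandsL, Params.farCands, hlen, hmap, List.filter_map]
  congr 1
  refine List.filter_congr fun x _ => ?_
  simp only [Function.comp_apply, encElem, isFarL_ctx]

/-- **`stepL` computes `step`.** [folklore] -/
theorem stepL_ctx (st : ℕ × List (Elem m)) : stepL m P.ctx (encSt st) = encSt (P.step st) := by
  obtain ⟨ptr, net⟩ := st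
  simp only [stepL, encSt, Params.step, List.length_map]
  split_ifs with h
  · have hget : (net.map encElem).getD ptr ([], zeroCols m) = encElem (net.getD ptr ([], 0)) := by
      rw [show (([] : List ℕ), zeroCols m) = encElem (m := m) ([], 0) from rfl, List.getD_map]
    rw [hget, farCandsL_ctx]
    rcases P.farCands net (net.getD ptr ([], 0)) with _ | ⟨c, cs⟩
    · simp
    · simp
  all_goals rfl

end Twin

/-! ### One round on codes -/

/-- `candL` on codes. [folklore] -/
theorem codeFP_candL : CodeFP (pairE Ctx.E (pairE (rawE (rawE gE)) natE)) (rawE (rawE gE))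
    fun p : Ctx × (List (List GaussianInt) × ℕ) => candL p.1 p.2.1 p.2.2 := by
  have hS : CodeFP (pairE Ctx.E (pairE (rawE (rawE gE)) natE)) intE fun p : Ctx × (List (List GaussianInt) × ℕ) => p.1.1 :=
    (fst _ _).fst'
  have hB : CodeFP (pairE Ctx.E (pairE (rawE (rawE gE)) natE)) intE fun p : Ctx × (List (List GaussianInt) × ℕ) => p.1.2.1 :=
    (fst _ _).snd'.fst'
  have hgens : CodeFP (pairE Ctx.E (pairE (rawE (rawE gE)) natE)) (rawE (rawE (rawE gE)))
      fun p : Ctx × (List (List GaussianInt) × ℕ) => p.1.2.2.2.2 := (fst _ _).snd'.snd'.snd'.snd'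
  have hX : CodeFP (pairE Ctx.E (pairE (rawE (rawE gE)) natE)) (rawE (rawE gE))
      fun p : Ctx × (List (List GaussianInt) × ℕ) => p.2.1 := (snd _ _).fst'
  have hi : CodeFP (pairE Ctx.E (pairE (rawE (rawE gE)) natE)) natE fun p : Ctx × (List (List GaussianInt) × ℕ) => p.2.2 :=
    (snd _ _).snd'
  have hA : CodeFP (pairE Ctx.E (pairE (rawE (rawE gE)) natE)) (rawE (rawE gE))
      fun p : Ctx × (List (List GaussianInt) × ℕ) => p.1.2.2.2.2.getD p.2.2 [] :=
    ((rawGetD (rawE (rawE gE)) (d := ([] : List (List GaussianInt))) rfl).comp (hgens.pair hi)).congr fun _ => rfl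
  have hR : CodeFP (pairE Ctx.E (pairE (rawE (rawE gE)) natE)) (rawE (rawE gE))
      fun p : Ctx × (List (List GaussianInt) × ℕ) => roundMulL p.1.1 (p.1.2.2.2.2.getD p.2.2 []) p.2.1 :=
    (codeFP_roundMulL.comp (hS.pair (hA.pair hX))).congr fun _ => rfl
  exact (codeFP_clampL.comp (hB.pair hR)).congr fun _ => rfl

/-- `isFarL` on codes. [folklore] -/
theorem codeFP_isFarL : CodeFP (pairE Ctx.E (pairE (rawE ElemL.E) (rawE (rawE gE)))) bitE
    fun p : Ctx × (List ElemL × List (List GaussianInt)) => isFarL p.1 p.2.1 p.2.2 := by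
  -- context `(c, Yc)`, item `e`
  have hT2 : CodeFP (pairE (pairE Ctx.E (rawE (rawE gE))) ElemL.E) intE
      fun t : (Ctx × List (List GaussianInt)) × ElemL => t.1.1.2.2.1 := (fst _ _).fst'.snd'.snd'.fst'
  have hS2 : CodeFP (pairE (pairE Ctx.E (rawE (rawE gE))) ElemL.E) intE
      fun t : (Ctx × List (List GaussianInt)) × ElemL => t.1.1.2.2.2.1 := (fst _ _).fst'.snd'.snd'.snd'.fst'
  have hY : CodeFP (pairE (pairE Ctx.E (rawE (rawE gE))) ElemL.E) (rawE (rawE gE))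
      fun t : (Ctx × List (List GaussianInt)) × ElemL => t.1.2 := (fst _ _).snd'
  have he : CodeFP (pairE (pairE Ctx.E (rawE (rawE gE))) ElemL.E) (rawE (rawE gE))
      fun t : (Ctx × List (List GaussianInt)) × ElemL => t.2.2 := (snd _ _).snd'
  have htest : CodeFP (pairE (pairE Ctx.E (rawE (rawE gE))) ElemL.E) bitE
      fun t : (Ctx × List (List GaussianInt)) × ElemL => closeTestL t.1.1.2.2.1 t.1.1.2.2.2.1 t.1.2 t.2.2 :=
    (codeFP_closeTestL.comp ((hT2.pair hS2).pair (hY.pair he))).congr fun _ => rfl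
  have hall := CodeFP.all htest.not
  exact (hall.comp (((fst _ _).pair (snd _ _).snd').pair (snd _ _).fst')).congr fun p => by
    simp only [isFarL]

/-- `farCandsL` on codes. [folklore] -/
theorem codeFP_farCandsL : CodeFP (pairE Ctx.E (pairE (rawE ElemL.E) ElemL.E)) (rawE ElemL.E)
    fun p : Ctx × (List ElemL × ElemL) => farCandsL p.1 p.2.1 p.2.2 := by
  -- the candidates: context `(c, e)`, items `i` of the range
  have hw : CodeFP (pairE (pairE Ctx.E ElemL.E) natE) (rawE natE)
      fun t : (Ctx × ElemL) × ℕ => t.1.2.1 ++ [t.2] :=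
    ((rawAppend natE).comp ((fst _ _).snd'.fst'.pair ((rawSingleton natE).comp (snd _ _)))).congr fun _ => rfl
  have hc : CodeFP (pairE (pairE Ctx.E ElemL.E) natE) (rawE (rawE gE))
      fun t : (Ctx × ElemL) × ℕ => candL t.1.1 t.1.2.2 t.2 :=
    (codeFP_candL.comp ((fst _ _).fst'.pair ((fst _ _).snd'.snd'.pair (snd _ _)))).congr fun _ => rfl
  have hitem : CodeFP (pairE (pairE Ctx.E ElemL.E) natE) ElemL.E
      fun t : (Ctx × ElemL) × ℕ => (t.1.2.1 ++ [t.2], candL t.1.1 t.1.2.2 t.2) := hw.pair hc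
  have hrange : CodeFP (pairE Ctx.E (pairE (rawE ElemL.E) ElemL.E)) (rawE natE)
      fun p : Ctx × (List ElemL × ElemL) => List.range p.1.2.2.2.2.length :=
    (urange.comp ((ulength _).comp (fst _ _).snd'.snd'.snd'.snd')).congr fun _ => rfl
  have hcands : CodeFP (pairE Ctx.E (pairE (rawE ElemL.E) ElemL.E)) (rawE ElemL.E)
      fun p : Ctx × (List ElemL × ElemL) =>
        (List.range p.1.2.2.2.2.length).map fun i => (p.2.2.1 ++ [i], candL p.1 p.2.2.2 i) :=
    ((map hitem).comp (((fst _ _).pair (snd _ _).snd').pair hrange)).congr fun _ => rfl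
  -- the filter: context `(c, net)`
  have hfar : CodeFP (pairE (pairE Ctx.E (rawE ElemL.E)) ElemL.E) bitE
      fun t : (Ctx × List ElemL) × ElemL => isFarL t.1.1 t.1.2 t.2.2 :=
    (codeFP_isFarL.comp ((fst _ _).fst'.pair ((fst _ _).snd'.pair (snd _ _).snd'))).congr fun _ => rfl
  exact ((filter hfar).comp (((fst _ _).pair (snd _ _).fst').pair hcands)).congr fun p => by
    simp only [farCandsL]

/-- **One round on codes.** [cite: AroraBarak2009, §1.3] -/
theorem codeFP_stepL (m : ℕ) : CodeFP (pairE Ctx.E StL.E) StL.E fun p : Ctx × StL => stepL m p.1 p.2 := by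
  have hc : CodeFP (pairE Ctx.E StL.E) Ctx.E fun p : Ctx × StL => p.1 := fst _ _
  have hptr : CodeFP (pairE Ctx.E StL.E) natE fun p : Ctx × StL => p.2.1 := (snd _ _).fst'
  have hnet : CodeFP (pairE Ctx.E StL.E) (rawE ElemL.E) fun p : Ctx × StL => p.2.2 := (snd _ _).snd'
  have hlen : CodeFP (pairE Ctx.E StL.E) natE fun p : Ctx × StL => p.2.2.length := ((natLength _).comp hnet).congr fun _ => rfl
  have hcond : CodeFP (pairE Ctx.E StL.E) bitE fun p : Ctx × StL => decide (p.2.1 < p.2.2.length) :=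
    (natLt.comp (hptr.pair hlen)).congr fun _ => rfl
  have helem : CodeFP (pairE Ctx.E StL.E) ElemL.E fun p : Ctx × StL => p.2.2.getD p.2.1 ([], zeroCols m) :=
    ((rawGetOr ElemL.E).comp (hnet.pair (hptr.pair (const _ (([] : List ℕ), zeroCols m))))).congr fun _ => rfl
  have hfc : CodeFP (pairE Ctx.E StL.E) (rawE ElemL.E) fun p : Ctx × StL => farCandsL p.1 p.2.2 (p.2.2.getD p.2.1 ([], zeroCols m)) :=
    (codeFP_farCandsL.comp (hc.pair (hnet.pair helem))).congr fun _ => rfl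
  -- case analysis on the far candidates, context `(ptr, net)`
  have hnil : CodeFP (pairE natE (rawE ElemL.E)) StL.E fun q : ℕ × List ElemL => (q.1 + 1, q.2) :=
    ((natAdd.comp ((fst _ _).pair (const _ 1))).pair (snd _ _)).congr fun _ => rfl
  have hcons : CodeFP (pairE (pairE natE (rawE ElemL.E)) (pairE ElemL.E (rawE ElemL.E))) StL.E
      fun t : (ℕ × List ElemL) × (ElemL × List ElemL) => (t.1.1, t.1.2 ++ [t.2.1]) :=
    ((fst _ _).fst'.pair ((rawAppend ElemL.E).comp ((fst _ _).snd'.pair ((rawSingleton ElemL.E).comp (snd _ _).fst')))).congr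
      fun _ => rfl
  have hcases := rawCases (k := fun (q : ℕ × List ElemL) (l : List ElemL) =>
      match l with | [] => (q.1 + 1, q.2) | x :: _ => (q.1, q.2 ++ [x])) hnil hcons (fun _ => rfl) (fun _ _ _ => rfl)
  have hthen : CodeFP (pairE Ctx.E StL.E) StL.E fun p : Ctx × StL =>
      match farCandsL p.1 p.2.2 (p.2.2.getD p.2.1 ([], zeroCols m)) with
      | [] => (p.2.1 + 1, p.2.2) | x :: _ => (p.2.1, p.2.2 ++ [x]) :=
    (hcases.comp ((hptr.pair hnet).pair hfc)).congr fun p => by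
      rcases farCandsL p.1 p.2.2 (p.2.2.getD p.2.1 ([], zeroCols m)) with _ | ⟨x, xs⟩ <;> rfl
  exact (hcond.ite hthen (snd _ _)).congr fun p => by
    simp only [stepL, decide_eq_true_eq]

end NetCompiler

end Literature.Computability.QuantumComplexity

end
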